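import Mathlib
import HarnessLib
import Literature.Geometry.Riemannian.TwoConvexSchoenfliesProofs
import Summits.ValiantsHypothesis.ValiantsHypothesis.Theorems.KPlusLogSqLawWeakLiftingTowerGraftWronskianKFourNewtonFive

/-!
# Tower graft line — CONJECTURE W AT `K = 4` PROVED ON THE SUPPORTS `(c, c+2h, c+4h, c+5h)` (septic Vieta, quadratic cofactor) AND MIRRORS

Helper file for LINE (B) `Cruxes/WeakLifting/Lines/tower_graft.lean` (crux `WeakLifting` = stmt-ValiantsHypothesis-19561), target (W-4) =
`ConjectureWAt 4`.  NO stub is claimed; `ConjectureWAt 4` stays OPEN in general.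
On `d = (c, c+2, c+4, c+5)` the pair sums are `2c+2, 2c+4, 2c+5, 2c+6, 2c+7, 2c+9`: `X·W(u,v) = X^{2c+2}·Q` with `Q` a SEPTIC with vanishing
`X¹` and `X⁶` coefficients, `(2p₀₁, 0, 4p₀₂, 5p₀₃, 2p₁₂, 3p₁₃, 0, p₂₃)`.  Five distinct positive zeros give `Q = (∏(X − rᵢ))·(c₂X² + c₁X + c₀)`
(the cofactor may have complex roots, so COEFFICIENTS are compared, not roots): `c₁ = e₁c₂`, `e₄c₀ = e₁e₅c₂`, and the weighted Plücker relation
`30·a₀a₇ − 5·a₂a₅ + 6·a₃a₄ = 0` becomes `c₂²·R(e) = 0` with `R` the polynomial of `…KFourNewtonFive.spreadFive_key_pos` (`−R > 0`).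
* ★★ `card_posRoots_wronskian_four_le_four_spreadFive` — `Z₊(W(u,v)) ≤ 4` on `(c, c+2, c+4, c+5)` for all real `u, v`;
* ★★ `…_spreadFive_scaled` / `…_spreadFive_mirror` — the same on `(c, c+2h, c+4h, c+5h)` and on `(c, c+h, c+3h, c+5h)`, `h ≥ 1`.
With `…KFourConsecutive(Scaled)` and `…KFourSextic`, EVERY support of spread `d₃ − d₀ ≤ 5` is now covered (balanced ones by `…WronskianDevelopable`).
HONEST FRAMING: support families only; nothing on S4/S4f/S5/S5ᴸ, TowerB, `WeakLifting`, Conjecture B, `MatrixDescartes` (18050), `VP ≠ VNP`.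
Def-free.  Seat: prover leafhand-val-kpluslogsqlaw-1 g12, `--supports stmt-ValiantsHypothesis-19561 --as helper`.  [Vieta folklore; this work]
-/

-- `Summit.ValiantsHypothesis.ValiantsHypothesis.…` repeats a component by the D-0017 layout
-- (single-conjunct summit), which the `dupNamespace` linter flags; the name is mandated.
set_option linter.dupNamespace false
set_option autoImplicit false

namespace Summit.ValiantsHypothesis.ValiantsHypothesis.Theorems.KPlusLogSqLaw.TowerGraft

open Polynomial Finset
open scoped BigOperators Polynomial

namespace WronskianDevelopable

/-- `X·W(u,v) = X^{2c+2}·Q` with `Q` the septic `2p₀₁ + 4p₀₂X² + 5p₀₃X³ + 2p₁₂X⁴ + 3p₁₃X⁵ + p₂₃X⁷`. [this work] -/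
theorem X_mul_wronskian_spreadFive_eq (u v : Fin 4 → ℝ) (c : ℕ) :
    (X : ℝ[X]) * wronskian (∑ l, C (u l) * (X : ℝ[X]) ^ (![c, c + 2, c + 4, c + 5] : Fin 4 → ℕ) l)
        (∑ l, C (v l) * (X : ℝ[X]) ^ (![c, c + 2, c + 4, c + 5] : Fin 4 → ℕ) l) =
      X ^ (2 * c + 2) *
        (C ((u 0 * v 1 - u 1 * v 0) * 2) + C ((u 0 * v 2 - u 2 * v 0) * 4) * X ^ 2 + C ((u 0 * v 3 - u 3 * v 0) * 5) * X ^ 3 +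
          C ((u 1 * v 2 - u 2 * v 1) * 2) * X ^ 4 + C ((u 1 * v 3 - u 3 * v 1) * 3) * X ^ 5 + C (u 2 * v 3 - u 3 * v 2) * X ^ 7) := by
  rw [X_mul_wronskian_four_eq]
  simp only [Matrix.cons_val_zero, Matrix.cons_val_one, Matrix.cons_val]
  push_cast
  have e1 : (X : ℝ[X]) ^ (c + (c + 2)) = X ^ (2 * c + 2) := by ring_nf
  have e2 : (X : ℝ[X]) ^ (c + (c + 4)) = X ^ (2 * c + 2) * X ^ 2 := by ring_nf
  have e3 : (X : ℝ[X]) ^ (c + (c + 5)) = X ^ (2 * c + 2) * X ^ 3 := by ring_nf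
  have e4 : (X : ℝ[X]) ^ (c + 2 + (c + 4)) = X ^ (2 * c + 2) * X ^ 4 := by ring_nf
  have e5 : (X : ℝ[X]) ^ (c + 2 + (c + 5)) = X ^ (2 * c + 2) * X ^ 5 := by ring_nf
  have e6 : (X : ℝ[X]) ^ (c + 4 + (c + 5)) = X ^ (2 * c + 2) * X ^ 7 := by ring_nf
  rw [e1, e2, e3, e4, e5, e6]
  have n1 : ((c : ℝ) + 2 - c) = 2 := by ring
  have n2 : ((c : ℝ) + 4 - c) = 4 := by ring
  have n3 : ((c : ℝ) + 5 - c) = 5 := by ring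
  have n4 : ((c : ℝ) + 4 - (c + 2)) = 2 := by ring
  have n5 : ((c : ℝ) + 5 - (c + 2)) = 3 := by ring
  have n6 : ((c : ℝ) + 5 - (c + 4)) = 1 := by ring
  rw [n1, n2, n3, n4, n5, n6, mul_one]
  ring

/-- ★★ **CONJECTURE W AT `K = 4` ON THE SUPPORTS `(c, c+2, c+4, c+5)`**: `Z₊(W(u,v)) ≤ 4` for all real `u, v`. [this work] -/
theorem card_posRoots_wronskian_four_le_four_spreadFive (u v : Fin 4 → ℝ) (c : ℕ) :
    ((wronskian (∑ l, C (u l) * (X : ℝ[X]) ^ (![c, c + 2, c + 4, c + 5] : Fin 4 → ℕ) l)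
        (∑ l, C (v l) * (X : ℝ[X]) ^ (![c, c + 2, c + 4, c + 5] : Fin 4 → ℕ) l)).roots.toFinset.filter
      (fun x => 0 < x)).card ≤ 4 := by
  classical
  have hdm : StrictMono (![c, c + 2, c + 4, c + 5] : Fin 4 → ℕ) := by
    refine Fin.strictMono_iff_lt_succ.mpr fun i => ?_
    fin_cases i <;> simp
  have hA : (![c, c + 2, c + 4, c + 5] : Fin 4 → ℕ) 0 + (![c, c + 2, c + 4, c + 5] : Fin 4 → ℕ) 3 <
      (![c, c + 2, c + 4, c + 5] : Fin 4 → ℕ) 1 + (![c, c + 2, c + 4, c + 5] : Fin 4 → ℕ) 2 := by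
    simp; omega
  set W : ℝ[X] := wronskian (∑ l, C (u l) * (X : ℝ[X]) ^ (![c, c + 2, c + 4, c + 5] : Fin 4 → ℕ) l)
        (∑ l, C (v l) * (X : ℝ[X]) ^ (![c, c + 2, c + 4, c + 5] : Fin 4 → ℕ) l) with hW
  have hXW := X_mul_wronskian_spreadFive_eq u v c
  rw [← hW] at hXW
  by_contra hgt
  have h5 : 5 ≤ (W.roots.toFinset.filter (fun x => 0 < x)).card := by omega
  by_cases hp23z : u 2 * v 3 - u 3 * v 2 = 0
  · have h4 := card_posRoots_wronskian_four_le_four_of_consecutive_nonneg u v _ hdm hA 4 (by norm_num) (by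
      simp [hp23z])
    exact hgt h4
  set q0 := (u 0 * v 1 - u 1 * v 0) * 2 with hq0
  set q2 := (u 0 * v 2 - u 2 * v 0) * 4 with hq2
  set q3 := (u 0 * v 3 - u 3 * v 0) * 5 with hq3
  set q4 := (u 1 * v 2 - u 2 * v 1) * 2 with hq4
  set q5 := (u 1 * v 3 - u 3 * v 1) * 3 with hq5
  set p23 := u 2 * v 3 - u 3 * v 2 with hp23def
  set Q : ℝ[X] := C q0 + C q2 * X ^ 2 + C q3 * X ^ 3 + C q4 * X ^ 4 + C q5 * X ^ 5 + C p23 * X ^ 7 with hQ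
  have hW0 : W ≠ 0 := by
    intro h0; rw [h0, roots_zero] at h5; simp at h5
  have hQ0 : Q ≠ 0 := by
    intro h0
    rw [h0, mul_zero] at hXW
    exact hW0 ((mul_eq_zero.mp hXW).resolve_left X_ne_zero)
  have hdegQ : Q.natDegree = 7 := by
    refine natDegree_eq_of_le_of_coeff_ne_zero (by rw [hQ]; compute_degree!) ?_
    rw [hQ]; simpa using hp23z
  -- five distinct positive zeros of `W`, all roots of `Q`
  obtain ⟨T, hTS, hT⟩ := Finset.exists_subset_card_eq h5
  have hTpos : ∀ x ∈ T, 0 < x := fun x hx => (Finset.mem_filter.mp (hTS hx)).2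
  have hTQ : ∀ x ∈ T, Q.IsRoot x := by
    intro x hx
    have hxW : W.IsRoot x := by
      have h := (Finset.mem_filter.mp (hTS hx)).1
      rw [Multiset.mem_toFinset] at h
      exact (mem_roots hW0).mp h
    have h1 : ((X : ℝ[X]) * W).eval x = 0 := by rw [eval_mul, hxW.eq_zero, mul_zero]
    rw [hXW, eval_mul, eval_pow, eval_X] at h1
    rcases mul_eq_zero.mp h1 with h | h
    · exact absurd (pow_eq_zero_iff (by omega) |>.mp h) (hTpos x hx).ne'
    · exact h
  have hTle : T.val ≤ Q.roots := by
    rw [Multiset.le_iff_subset T.nodup]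
    intro x hx
    exact (mem_roots hQ0).mpr (hTQ x hx)
  -- factor `Q = P5 · R2` with `R2` quadratic (compare coefficients; the roots of `R2` may be complex)
  obtain ⟨R2, hQR⟩ := (Multiset.prod_X_sub_C_dvd_iff_le_roots hQ0 T.val).mpr hTle
  set P5 : ℝ[X] := (T.val.map fun a => X - C a).prod with hP5
  have hP5deg : P5.natDegree = 5 := by
    rw [hP5, natDegree_multiset_prod_X_sub_C_eq_card, Finset.card_val, hT]
  have hP5ne : P5 ≠ 0 := (monic_multisetProd_X_sub_C T.val).ne_zero
  have hRne : R2 ≠ 0 := by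
    intro h0; rw [h0, mul_zero] at hQR; exact hQ0 hQR
  have hRdeg : R2.natDegree = 2 := by
    have := natDegree_mul hP5ne hRne
    rw [← hQR, hdegQ, hP5deg] at this
    omega
  have hRform : R2 = C (R2.coeff 0) + C (R2.coeff 1) * X + C (R2.coeff 2) * X ^ 2 := by
    have h := R2.as_sum_range_C_mul_X_pow
    rw [hRdeg] at h
    rw [h]
    simp [Finset.sum_range_succ]
  set c0 := R2.coeff 0 with hc0def
  set c1 := R2.coeff 1 with hc1def
  set c2 := R2.coeff 2 with hc2def
  -- explicit roots and the product form of `P5`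
  set r : Fin 5 → ℝ := fun m => T.orderEmbOfFin hT m with hr_def
  have hr : StrictMono r := fun i j hij => (T.orderEmbOfFin hT).strictMono hij
  have hrT : ∀ m, r m ∈ T := fun m => Finset.orderEmbOfFin_mem T hT m
  have hr0 : ∀ m, 0 < r m := fun m => hTpos _ (hrT m)
  have hs5 : T.val = r 0 ::ₘ r 1 ::ₘ r 2 ::ₘ r 3 ::ₘ r 4 ::ₘ 0 := by
    symm
    refine Multiset.eq_of_le_of_card_le ?_ ?_
    · rw [Multiset.le_iff_subset (by simp [Multiset.nodup_cons, hr.injective.eq_iff])]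
      intro x hx
      simp only [Multiset.mem_cons, Multiset.notMem_zero, or_false] at hx
      rcases hx with h | h | h | h | h <;> (rw [h]; exact hrT _)
    · simp [hT]
  have hP5prod : P5 = (X - C (r 0)) * ((X - C (r 1)) * ((X - C (r 2)) * ((X - C (r 3)) * (X - C (r 4))))) := by
    rw [hP5, hs5]; simp
  obtain ⟨e1, he1⟩ : ∃ e1 : ℝ, e1 = (r 0 + r 1 + r 2 + r 3 + r 4) := ⟨_, rfl⟩
  obtain ⟨e2, he2⟩ : ∃ e2 : ℝ, e2 = (r 0 * r 1 + r 0 * r 2 + r 0 * r 3 + r 0 * r 4 + r 1 * r 2 + r 1 * r 3 + r 1 * r 4 + r 2 * r 3 + r 2 * r 4 + r 3 * r 4) := ⟨_, rfl⟩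
  obtain ⟨e3, he3⟩ : ∃ e3 : ℝ, e3 = (r 0 * r 1 * r 2 + r 0 * r 1 * r 3 + r 0 * r 1 * r 4 + r 0 * r 2 * r 3 + r 0 * r 2 * r 4 + r 0 * r 3 * r 4 +
      r 1 * r 2 * r 3 + r 1 * r 2 * r 4 + r 1 * r 3 * r 4 + r 2 * r 3 * r 4) := ⟨_, rfl⟩
  obtain ⟨e4, he4⟩ : ∃ e4 : ℝ, e4 = (r 0 * r 1 * r 2 * r 3 + r 0 * r 1 * r 2 * r 4 + r 0 * r 1 * r 3 * r 4 + r 0 * r 2 * r 3 * r 4 + r 1 * r 2 * r 3 * r 4) := ⟨_, rfl⟩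
  obtain ⟨e5, he5⟩ : ∃ e5 : ℝ, e5 = (r 0 * r 1 * r 2 * r 3 * r 4) := ⟨_, rfl⟩
  -- the product, expanded
  have hprod : Q = C (-(e5 * c0)) + C (e4 * c0 - e5 * c1) * X + C (-(e3 * c0) + e4 * c1 - e5 * c2) * X ^ 2 +
      C (e2 * c0 - e3 * c1 + e4 * c2) * X ^ 3 + C (-(e1 * c0) + e2 * c1 - e3 * c2) * X ^ 4 +
      C (c0 - e1 * c1 + e2 * c2) * X ^ 5 + C (c1 - e1 * c2) * X ^ 6 + C c2 * X ^ 7 := by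
    rw [hQR, hP5prod, hRform, he1, he2, he3, he4, he5]
    simp only [map_add, map_sub, map_mul, map_neg]
    ring
  -- coefficient equations
  -- name the coefficients of the product (keeps `C (…)` atomic for coefficient extraction)
  generalize hb0 : -(e5 * c0) = b0 at hprod
  generalize hb1 : e4 * c0 - e5 * c1 = b1 at hprod
  generalize hb2 : -(e3 * c0) + e4 * c1 - e5 * c2 = b2 at hprod
  generalize hb3 : e2 * c0 - e3 * c1 + e4 * c2 = b3 at hprod
  generalize hb4 : -(e1 * c0) + e2 * c1 - e3 * c2 = b4 at hprod
  generalize hb5 : c0 - e1 * c1 + e2 * c2 = b5 at hprod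
  generalize hb6 : c1 - e1 * c2 = b6 at hprod
  have k0 : q0 = b0 := by
    have := congrArg (fun P : ℝ[X] => P.coeff 0) hprod
    norm_num [hQ, coeff_add, coeff_C_mul_X_pow, coeff_C_mul_X, coeff_C, coeff_X_pow, coeff_C_mul, coeff_X] at this
    linarith
  have k1 : (0:ℝ) = b1 := by
    have := congrArg (fun P : ℝ[X] => P.coeff 1) hprod
    norm_num [hQ, coeff_add, coeff_C_mul_X_pow, coeff_C_mul_X, coeff_C, coeff_X_pow, coeff_C_mul, coeff_X] at this
    linarith
  have k2 : q2 = b2 := by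
    have := congrArg (fun P : ℝ[X] => P.coeff 2) hprod
    norm_num [hQ, coeff_add, coeff_C_mul_X_pow, coeff_C_mul_X, coeff_C, coeff_X_pow, coeff_C_mul, coeff_X] at this
    linarith
  have k3 : q3 = b3 := by
    have := congrArg (fun P : ℝ[X] => P.coeff 3) hprod
    norm_num [hQ, coeff_add, coeff_C_mul_X_pow, coeff_C_mul_X, coeff_C, coeff_X_pow, coeff_C_mul, coeff_X] at this
    linarith
  have k4 : q4 = b4 := by
    have := congrArg (fun P : ℝ[X] => P.coeff 4) hprod
    norm_num [hQ, coeff_add, coeff_C_mul_X_pow, coeff_C_mul_X, coeff_C, coeff_X_pow, coeff_C_mul, coeff_X] at this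
    linarith
  have k5 : q5 = b5 := by
    have := congrArg (fun P : ℝ[X] => P.coeff 5) hprod
    norm_num [hQ, coeff_add, coeff_C_mul_X_pow, coeff_C_mul_X, coeff_C, coeff_X_pow, coeff_C_mul, coeff_X] at this
    linarith
  have k6 : (0:ℝ) = b6 := by
    have := congrArg (fun P : ℝ[X] => P.coeff 6) hprod
    norm_num [hQ, coeff_add, coeff_C_mul_X_pow, coeff_C_mul_X, coeff_C, coeff_X_pow, coeff_C_mul, coeff_X] at this
    linarith
  have k7 : p23 = c2 := by
    have := congrArg (fun P : ℝ[X] => P.coeff 7) hprod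
    norm_num [hQ, coeff_add, coeff_C_mul_X_pow, coeff_C_mul_X, coeff_C, coeff_X_pow, coeff_C_mul, coeff_X] at this
    linarith
  rw [← hb0] at k0; rw [← hb1] at k1; rw [← hb2] at k2; rw [← hb3] at k3; rw [← hb4] at k4; rw [← hb5] at k5
  rw [← hb6] at k6
  -- the Plücker relation `p₀₁p₂₃ − p₀₂p₁₃ + p₀₃p₁₂ = 0`, times `60`
  have plucker : 30 * q0 * p23 - 5 * q2 * q5 + 6 * q3 * q4 = 0 := by
    rw [hq0, hq2, hq3, hq4, hq5, hp23def]; ring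
  have hc1 : c1 = e1 * c2 := by linear_combination -k6
  rw [k0, k2, k3, k4, k5, k7, hc1] at plucker
  have hc0 : e4 * c0 - e1 * e5 * c2 = 0 := by rw [hc1] at k1; linear_combination -k1
  have hc2 : c2 ≠ 0 := by rw [← k7]; exact hp23z
  -- eliminate `c₀, c₁`: `c₂² · R(e) = 0`
  have key : c2 ^ 2 * (-6 * e3 * e4 ^ 3 + 5 * e2 * e4 ^ 2 * e5 - 25 * e1 * e4 * e5 ^ 2 + 6 * e1 * e3 ^ 2 * e4 ^ 2 + e1 * e2 * e4 ^ 3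
        - e1 * e2 * e3 * e4 * e5 - 16 * e1 ^ 2 * e4 ^ 2 * e5 + 5 * e1 ^ 2 * e3 * e5 ^ 2 - 6 * e1 ^ 2 * e2 * e3 * e4 ^ 2
        + 6 * e1 ^ 2 * e2 ^ 2 * e4 * e5 + 5 * e1 ^ 3 * e4 ^ 3 + e1 ^ 3 * e3 * e4 * e5 - 6 * e1 ^ 3 * e2 * e5 ^ 2) = 0 := by
    linear_combination (e4 ^ 2) * plucker -
      ((5 * e3 - 6 * e1 * e2) * (e4 * c0 + e1 * e5 * c2) +
        (e1 ^ 2 * e3 - e2 * e3 - 11 * e1 * e4 - 25 * e5 + 6 * e1 * e2 ^ 2) * e4 * c2) * hc0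
  have hR0 : (-6 * e3 * e4 ^ 3 + 5 * e2 * e4 ^ 2 * e5 - 25 * e1 * e4 * e5 ^ 2 + 6 * e1 * e3 ^ 2 * e4 ^ 2 + e1 * e2 * e4 ^ 3
        - e1 * e2 * e3 * e4 * e5 - 16 * e1 ^ 2 * e4 ^ 2 * e5 + 5 * e1 ^ 2 * e3 * e5 ^ 2 - 6 * e1 ^ 2 * e2 * e3 * e4 ^ 2
        + 6 * e1 ^ 2 * e2 ^ 2 * e4 * e5 + 5 * e1 ^ 3 * e4 ^ 3 + e1 ^ 3 * e3 * e4 * e5 - 6 * e1 ^ 3 * e2 * e5 ^ 2) = 0 := by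
    rcases mul_eq_zero.mp key with h | h
    · exact absurd (pow_eq_zero_iff two_ne_zero |>.mp h) hc2
    · exact h
  have hpos := spreadFive_key_pos r hr0 e1 e2 e3 e4 e5 he1 he2 he3 he4 he5
  linarith

/-! ## Homothety, mirror, and every support of spread `≤ 5` -/

/-- ★★ **CONJECTURE W AT `K = 4` ON THE SUPPORTS `(c, c+2h, c+4h, c+5h)`** (`h ≥ 1`). [this work] -/
theorem card_posRoots_wronskian_four_le_four_spreadFive_scaled (u v : Fin 4 → ℝ) (c h : ℕ) (hh : 0 < h) :
    ((wronskian (∑ l, C (u l) * (X : ℝ[X]) ^ (![c, c + 2 * h, c + 4 * h, c + 5 * h] : Fin 4 → ℕ) l)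
        (∑ l, C (v l) * (X : ℝ[X]) ^ (![c, c + 2 * h, c + 4 * h, c + 5 * h] : Fin 4 → ℕ) l)).roots.toFinset.filter
      (fun x => 0 < x)).card ≤ 4 := by
  have hfun : (![c, c + 2 * h, c + 4 * h, c + 5 * h] : Fin 4 → ℕ) = fun l => c + h * (![0, 2, 4, 5] : Fin 4 → ℕ) l := by
    funext l; fin_cases l <;> simp <;> ring
  rw [hfun]
  refine (card_posRoots_wronskian_scaled_le u v _ c h hh).trans ?_
  have h0 : (![0, 2, 4, 5] : Fin 4 → ℕ) = ![0, 0 + 2, 0 + 4, 0 + 5] := by norm_num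
  rw [h0]
  exact card_posRoots_wronskian_four_le_four_spreadFive u v 0

/-- ★★ **CONJECTURE W AT `K = 4` ON THE MIRROR SUPPORTS `(c, c+h, c+3h, c+5h)`** (`h ≥ 1`). [this work] -/
theorem card_posRoots_wronskian_four_le_four_spreadFive_mirror (u v : Fin 4 → ℝ) (c h : ℕ) (hh : 0 < h) :
    ((wronskian (∑ l, C (u l) * (X : ℝ[X]) ^ (![c, c + h, c + 3 * h, c + 5 * h] : Fin 4 → ℕ) l)
        (∑ l, C (v l) * (X : ℝ[X]) ^ (![c, c + h, c + 3 * h, c + 5 * h] : Fin 4 → ℕ) l)).roots.toFinset.filter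
      (fun x => 0 < x)).card ≤ 4 := by
  set d : Fin 4 → ℕ := ![c, c + h, c + 3 * h, c + 5 * h] with hd
  have hD : ∀ l, d l ≤ c + 5 * h := by
    intro l; fin_cases l <;> simp [hd] <;> omega
  refine (card_posRoots_wronskian_le_reflect u v d (c + 5 * h) hD).trans ?_
  have hexp : ∀ l : Fin 4, c + 5 * h - d (Fin.rev l) = 0 + h * (![0, 2, 4, 5] : Fin 4 → ℕ) l := by
    intro l
    fin_cases l
    · show c + 5 * h - d (Fin.rev 0) = 0 + h * 0
      rw [show Fin.rev (0 : Fin 4) = 3 by decide]; simp [hd]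
    · show c + 5 * h - d (Fin.rev 1) = 0 + h * 2
      rw [show Fin.rev (1 : Fin 4) = 2 by decide]; simp [hd]; omega
    · show c + 5 * h - d (Fin.rev 2) = 0 + h * 4
      rw [show Fin.rev (2 : Fin 4) = 1 by decide]; simp [hd]; omega
    · show c + 5 * h - d (Fin.rev 3) = 0 + h * 5
      rw [show Fin.rev (3 : Fin 4) = 0 by decide]; simp [hd]; omega
  simp_rw [hexp]
  refine (card_posRoots_wronskian_scaled_le (fun l => u (Fin.rev l)) (fun l => v (Fin.rev l)) _ 0 h hh).trans ?_
  have h0 : (![0, 2, 4, 5] : Fin 4 → ℕ) = ![0, 0 + 2, 0 + 4, 0 + 5] := by norm_num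
  rw [h0]
  exact card_posRoots_wronskian_four_le_four_spreadFive _ _ 0

/-- ★★★ **CONJECTURE W AT `K = 4` ON EVERY SUPPORT OF SPREAD `d₃ − d₀ ≤ 5`.**  The ten shapes are: balanced `(0,1,2,3)`, `(0,1,3,4)`,
`(0,1,4,5)`, `(0,2,3,5)` (`…WronskianDevelopable`); `(0,2,3,4)`, `(0,1,2,4)` (`…KFourConsecutive(Scaled)`); `(0,3,4,5)`, `(0,1,2,5)`
(`…KFourSextic`); `(0,2,4,5)`, `(0,1,3,5)` (this file). [this work] -/
theorem card_posRoots_wronskian_four_le_four_of_spread_le_five (u v : Fin 4 → ℝ) (d : Fin 4 → ℕ) (hd : StrictMono d)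
    (h5 : d 3 ≤ d 0 + 5) :
    ((wronskian (∑ l, C (u l) * (X : ℝ[X]) ^ d l) (∑ l, C (v l) * (X : ℝ[X]) ^ d l)).roots.toFinset.filter
      (fun x => 0 < x)).card ≤ 4 := by
  have h01 : d 0 < d 1 := hd (by decide)
  have h12 : d 1 < d 2 := hd (by decide)
  have h23 : d 2 < d 3 := hd (by decide)
  obtain ⟨i, hi⟩ : ∃ i, d 1 = d 0 + i := ⟨d 1 - d 0, by omega⟩
  obtain ⟨j, hj⟩ : ∃ j, d 2 = d 0 + j := ⟨d 2 - d 0, by omega⟩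
  obtain ⟨k, hk⟩ : ∃ k, d 3 = d 0 + k := ⟨d 3 - d 0, by omega⟩
  have hfun : d = ![d 0, d 0 + i, d 0 + j, d 0 + k] := by
    funext l; fin_cases l
    · rfl
    · exact hi
    · exact hj
    · exact hk
  have hi1 : 1 ≤ i := by omega
  have hi3 : i ≤ 3 := by omega
  have hij : i + 1 ≤ j := by omega
  have hj4 : j ≤ 4 := by omega
  have hjk : j + 1 ≤ k := by omega
  have hk5 : k ≤ 5 := by omega
  rw [hfun]
  have bal : ∀ (w : Fin 4 → ℕ), w 0 + w 3 = w 1 + w 2 →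
      ((wronskian (∑ l, C (u l) * (X : ℝ[X]) ^ w l) (∑ l, C (v l) * (X : ℝ[X]) ^ w l)).roots.toFinset.filter
        (fun x => 0 < x)).card ≤ 4 := fun w hw => card_posRoots_wronskian_le_four_of_balanced u v w hw
  have mc := card_posRoots_wronskian_four_le_four_consecutive_mirror u v (d 0) 1 one_pos
  have ms := card_posRoots_wronskian_four_le_four_sextic_mirror u v (d 0) 1 one_pos
  have mf := card_posRoots_wronskian_four_le_four_spreadFive_mirror u v (d 0) 1 one_pos
  simp only [mul_one] at mc ms mf
  interval_cases i <;> interval_cases j <;> interval_cases k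
  · exact bal _ (by simp; omega)
  · exact mc
  · exact ms
  · exact bal _ (by simp; omega)
  · exact mf
  · exact bal _ (by simp; omega)
  · exact card_posRoots_wronskian_four_le_four_consecutive u v (d 0)
  · exact bal _ (by simp; omega)
  · exact card_posRoots_wronskian_four_le_four_spreadFive u v (d 0)
  · exact card_posRoots_wronskian_four_le_four_sextic u v (d 0)

end WronskianDevelopable

end Summit.ValiantsHypothesis.ValiantsHypothesis.Theorems.KPlusLogSqLaw.TowerGraft
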